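import Literature.Computability.QuantumComplexity.PauliLocal
import Literature.Computability.QuantumComplexity.QubitChannelLemma8
import Mathlib.Algebra.BigOperators.Ring.Finset
import HarnessLib

/-!
# Noisy gates in the Pauli picture: the two induction steps of Lemma 7

The two gate cases of the proof of Lemma 7 of Kempe–Regev–Unger–de Wolf, Quantum Inf. Comput.
10 (2010) 361–376 [KempeEtAl2010], §3.1.2, on a register `ι → Bool`, for the Pauli weights
`F(M, W) = pauliWeight M W = Σ_{supp S ⊆ W} |Tr(S M)|²` (so that the paper's invariant reads
`F(δ, V) ≤ 2 · 2^{|V|} θ^{dist V}`):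

* **Case 2 (one-qubit gate followed by noise).** `pauliCoeff_krausAt_update` is the slice
  identity `Tr(S[j↦Q] · G_j(M)) = Σ_{Q'} T_{QQ'} Tr(S[j↦Q'] · M)` for a one-qubit Kraus channel
  `G` placed at wire `j` (`T` its Pauli transfer matrix); with Lemma 8
  (`kruw_lemma8_complex`) and Observation 4 this gives `pauliWeight_noisyQubitGate_le`:
  if `F(M, W') ≤ c 2^{|W'|}` for all `W'`, then for `j ∈ W` and noise rate `p ∈ [0,1]`,
  `F(N_j^p(G_j M), W) ≤ ((1 + (1−p)²)/2) · c · 2^{|W|}` — the printed computation ending in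
  "`≤ (1+(1−ε₁)²)/(2θ) · 2 · 2^{|V''|} θ^{dist V''}`".
* **Case 1 (noise on a block `A`, then a unitary acting inside `A`).**
  `pauliCoeff_depolarizeList` (the shrinking factor `μ^{|supp S ∩ A|}`),
  `sum_stringsOn_shrink_eq_sum_powerset` (the regrouping
  `Σ_S μ^{2|supp S ∩ A|} |M̂(S)|² = Σ_{a ⊆ A} μ^{2|a|}(1−μ²)^{k−|a|} F(M, (W∖A) ∪ a)`) and
  `pauliWeight_noisyUnitary_le`: if `F(M, W') ≤ c 2^{|W'|}` for all `W'`, `U` is unitary and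
  commutes with the single-site Paulis outside `A`, and `W ∩ A ≠ ∅`, then
  `F(U N_A^p(M) Uᴴ, W) ≤ ((1 + (1−p)²)^{|A|}/2) · c · 2^{|W|}`.

Distances (`θ^{dist}`) are bookkept by the caller; here `c` is an arbitrary nonnegative constant.

## References

* [KempeEtAl2010] J. Kempe, O. Regev, F. Unger, R. de Wolf, Quantum Inf. Comput. 10 (2010)
  361–376; arXiv:0802.1464, §3.1.2 (Cases 1 and 2), Observations 2–4 and 6, Lemma 8.
-/

noncomputable section

open Matrix Finset

namespace Literature.Computability.QuantumComplexity

variable {ι : Type*} [Fintype ι] [DecidableEq ι] {κ : Type*} [Fintype κ]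

/-! ### Case 2: a one-qubit channel at wire `j` -/

omit [Fintype ι] in
/-- Updating the matrix-valued string at `j`. [folklore] -/
theorem update_mat_eq (S : ι → Pauli) (j : ι) (Q : Pauli) :
    Function.update (fun i => (S i).mat) j (Pauli.mat Q) = fun i => (Function.update S j Q i).mat := by
  funext i
  by_cases h : i = j
  · subst h; simp
  · simp [Function.update_of_ne h]

/-- Conjugate transpose of a one-slot tensor product. [folklore] -/
theorem conjTranspose_tensorAll_update_one (j : ι) (K : Matrix Bool Bool ℂ) :
    (tensorAll (Function.update (fun _ : ι => (1 : Matrix Bool Bool ℂ)) j K))ᴴ =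
      tensorAll (Function.update (fun _ : ι => (1 : Matrix Bool Bool ℂ)) j Kᴴ) := by
  rw [conjTranspose_tensorAll]
  congr 1
  funext i
  by_cases h : i = j
  · subst h; simp
  · simp [Function.update_of_ne h]

/-- **Slice identity for a one-qubit channel at wire `j`.** For a Kraus family `K` placed at
`j` (`K̃ᵢ = 1 ⊗ … ⊗ Kᵢ ⊗ … ⊗ 1`) and any string `S`,
`Tr(S[j↦Q] · Σ K̃ᵢ M K̃ᵢᴴ) = Σ_{Q'} (½ Tr(σ_Q G(σ_{Q'}))) · Tr(S[j↦Q'] · M)`: on each slice the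
channel acts through its Pauli transfer matrix. [cite: KempeEtAl2010, §3.1.2 Case 2 (δ_{V''} from δ_{V'})] -/
theorem pauliCoeff_krausAt_update (K : κ → Matrix Bool Bool ℂ) (j : ι)
    (M : Matrix (ι → Bool) (ι → Bool) ℂ) (S : ι → Pauli) (Q : Pauli) :
    pauliCoeff (∑ i, tensorAll (Function.update (fun _ : ι => (1 : Matrix Bool Bool ℂ)) j (K i)) * M *
      (tensorAll (Function.update (fun _ : ι => (1 : Matrix Bool Bool ℂ)) j (K i)))ᴴ)
      (Function.update S j Q) =
    ∑ Q', (Pauli.mat Q * ∑ i, K i * Pauli.mat Q' * (K i)ᴴ).trace / 2 *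
      pauliCoeff M (Function.update S j Q') := by
  -- move the Kraus operators onto the string
  have step1 : ∀ i, (pauliString (Function.update S j Q) *
      (tensorAll (Function.update (fun _ : ι => (1 : Matrix Bool Bool ℂ)) j (K i)) * M *
        (tensorAll (Function.update (fun _ : ι => (1 : Matrix Bool Bool ℂ)) j (K i)))ᴴ)).trace =
      (tensorAll (Function.update (fun i => (S i).mat) j ((K i)ᴴ * Pauli.mat Q * K i)) * M).trace := by
    intro i
    rw [conjTranspose_tensorAll_update_one, ← Matrix.mul_assoc, trace_mul_cycle, ← Matrix.mul_assoc,
      pauliString_eq, ← update_mat_eq, tensorAll_mul, tensorAll_mul]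
    congr 3
    funext i'
    by_cases h : i' = j
    · subst h; simp [Matrix.mul_assoc]
    · simp [Function.update_of_ne h]
  rw [pauliCoeff_eq, Matrix.mul_sum, trace_sum]
  simp only [step1]
  rw [← trace_sum, ← Finset.sum_mul, ← tensorAll_update_sum]
  -- expand the `2 × 2` matrix `Σ Kᵢᴴ σ_Q Kᵢ` in the Pauli basis
  set D : Matrix Bool Bool ℂ := ∑ i, (K i)ᴴ * Pauli.mat Q * K i with hD
  have hDexp := Pauli.eq_half_sum_trace_smul D
  have hcoefD : ∀ Q', (Pauli.mat Q' * D).trace = (Pauli.mat Q * ∑ i, K i * Pauli.mat Q' * (K i)ᴴ).trace := by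
    intro Q'
    rw [hD, Matrix.mul_sum, Matrix.mul_sum, trace_sum, trace_sum]
    refine Finset.sum_congr rfl fun i _ => ?_
    rw [← Matrix.mul_assoc, ← Matrix.mul_assoc, trace_mul_comm, ← Matrix.mul_assoc,
      ← Matrix.mul_assoc, trace_mul_comm]
  conv_lhs => rw [hDexp]
  rw [tensorAll_update_smul, tensorAll_update_sum, Matrix.smul_mul, Finset.sum_mul, trace_smul,
    trace_sum, smul_eq_mul, Finset.mul_sum]
  refine Finset.sum_congr rfl fun Q' _ => ?_
  rw [tensorAll_update_smul, Matrix.smul_mul, trace_smul, smul_eq_mul, update_mat_eq, ← pauliString_eq,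
    ← pauliCoeff_eq, hcoefD]
  ring

/-- The `I`-row of the (complex) transfer matrix of a trace-preserving Kraus family is
`(1, 0, 0, 0)`. [cite: KempeEtAl2010, Lemma 8 (first row of J)] -/
theorem transfer_row_I_complex (K : κ → Matrix Bool Bool ℂ) (hK : ∑ i, (K i)ᴴ * K i = 1) (Q' : Pauli) :
    (Pauli.mat Pauli.I * ∑ i, K i * Pauli.mat Q' * (K i)ᴴ).trace / 2 = if Q' = Pauli.I then 1 else 0 := by
  rw [show Pauli.mat Pauli.I = 1 from rfl, Matrix.one_mul, trace_kraus K hK]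
  have h := Pauli.trace_mat_mul_mat Pauli.I Q'
  rw [show Pauli.mat Pauli.I = 1 from rfl, Matrix.one_mul] at h
  rw [h]
  by_cases hQ : Q' = Pauli.I
  · subst hQ; simp
  · rw [if_neg (Ne.symm hQ), if_neg hQ]; simp

/-- **Case 2 of Lemma 7: a one-qubit channel followed by `p`-depolarizing noise.** If all
weights of `M` satisfy `F(M, W') ≤ c · 2^{|W'|}`, then for `j ∈ W` and `0 ≤ p ≤ 1` the weight
of `N_j^p(G_j(M))` on `W` is at most `((1 + (1−p)²)/2) · c · 2^{|W|}`: by the slice identity,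
Lemma 8 and Observation 4 it is at most
`(1 + (1−p)²(1−2β)) F(M, W∖j) + (1−p)² β F(M, W)`. [cite: KempeEtAl2010, §3.1.2 Case 2] -/
theorem pauliWeight_noisyQubitGate_le (K : κ → Matrix Bool Bool ℂ) (hK : ∑ i, (K i)ᴴ * K i = 1)
    {p : ℝ} (hp0 : 0 ≤ p) (hp1 : p ≤ 1) (M : Matrix (ι → Bool) (ι → Bool) ℂ) {W : Finset ι}
    {j : ι} (hj : j ∈ W) {c : ℝ} (hM : ∀ W' : Finset ι, pauliWeight M W' ≤ c * 2 ^ W'.card) :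
    pauliWeight ((1 - (p : ℂ)) • (∑ i, tensorAll (Function.update (fun _ : ι => (1 : Matrix Bool Bool ℂ)) j (K i)) *
        M * (tensorAll (Function.update (fun _ : ι => (1 : Matrix Bool Bool ℂ)) j (K i)))ᴴ) +
      (p : ℂ) • ((1 / 4 : ℂ) • ∑ Q, pauliString (Function.update (fun _ : ι => Pauli.I) j Q) *
        (∑ i, tensorAll (Function.update (fun _ : ι => (1 : Matrix Bool Bool ℂ)) j (K i)) * M *
          (tensorAll (Function.update (fun _ : ι => (1 : Matrix Bool Bool ℂ)) j (K i)))ᴴ) *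
        pauliString (Function.update (fun _ : ι => Pauli.I) j Q))) W ≤
      (1 + (1 - p) ^ 2) / 2 * c * 2 ^ W.card := by
  obtain ⟨β, hβ0, hβ1, hβ⟩ := kruw_lemma8_complex K hK
  set ν : ℝ := 1 - p with hν
  have hν0 : 0 ≤ ν := by rw [hν]; linarith
  have hν1 : ν ≤ 1 := by rw [hν]; linarith
  have hνsq : ν ^ 2 ≤ 1 := by nlinarith
  -- abbreviations
  set G : Matrix (ι → Bool) (ι → Bool) ℂ := ∑ i, tensorAll (Function.update (fun _ : ι =>
    (1 : Matrix Bool Bool ℂ)) j (K i)) * M * (tensorAll (Function.update (fun _ : ι =>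
      (1 : Matrix Bool Bool ℂ)) j (K i)))ᴴ with hG
  set T : Pauli → Pauli → ℂ := fun Q Q' => (Pauli.mat Q * ∑ i, K i * Pauli.mat Q' * (K i)ᴴ).trace / 2
    with hT
  -- the per-slice bound
  have slice : ∀ S' : ι → Pauli,
      ∑ Q, ‖pauliCoeff ((1 - (p : ℂ)) • G + (p : ℂ) • ((1 / 4 : ℂ) • ∑ Q,
        pauliString (Function.update (fun _ : ι => Pauli.I) j Q) * G *
          pauliString (Function.update (fun _ : ι => Pauli.I) j Q))) (Function.update S' j Q)‖ ^ 2 ≤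
      (1 + ν ^ 2 * (1 - 2 * β)) * ‖pauliCoeff M (Function.update S' j Pauli.I)‖ ^ 2 +
        ν ^ 2 * β * ∑ Q, ‖pauliCoeff M (Function.update S' j Q)‖ ^ 2 := by
    intro S'
    set v : Pauli → ℂ := fun Q' => pauliCoeff M (Function.update S' j Q') with hv
    have hcoef : ∀ Q, pauliCoeff ((1 - (p : ℂ)) • G + (p : ℂ) • ((1 / 4 : ℂ) • ∑ Q,
        pauliString (Function.update (fun _ : ι => Pauli.I) j Q) * G *
          pauliString (Function.update (fun _ : ι => Pauli.I) j Q))) (Function.update S' j Q) =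
        (if Q = Pauli.I then 1 else 1 - (p : ℂ)) * ∑ Q', T Q Q' * v Q' := by
      intro Q
      rw [pauliCoeff_depolarize, Function.update_self, hG, pauliCoeff_krausAt_update]
    have hI : ∑ Q', T Pauli.I Q' * v Q' = v Pauli.I := by
      simp only [hT, transfer_row_I_complex K hK, ite_mul, one_mul, zero_mul, Finset.sum_ite_eq',
        Finset.mem_univ, if_true]
    have hL8 := hβ v
    have hnorm : ‖(1 : ℂ) - (p : ℂ)‖ = ν := by
      rw [← Complex.ofReal_one, ← Complex.ofReal_sub, Complex.norm_real, Real.norm_of_nonneg hν0]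
    rw [Finset.sum_congr rfl fun Q _ => by rw [hcoef Q], Pauli.sum_univ]
    simp only [if_true, reduceCtorEq, if_false, one_mul, norm_mul, hnorm]
    rw [hI, Pauli.sum_univ (f := fun Q => ‖pauliCoeff M (Function.update S' j Q)‖ ^ 2)]
    change ‖v Pauli.I‖ ^ 2 + (ν * ‖∑ Q', T Pauli.X Q' * v Q'‖) ^ 2 + (ν * ‖∑ Q', T Pauli.Y Q' * v Q'‖) ^ 2 +
      (ν * ‖∑ Q', T Pauli.Z Q' * v Q'‖) ^ 2 ≤ (1 + ν ^ 2 * (1 - 2 * β)) * ‖v Pauli.I‖ ^ 2 +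
        ν ^ 2 * β * (‖v Pauli.I‖ ^ 2 + ‖v Pauli.X‖ ^ 2 + ‖v Pauli.Y‖ ^ 2 + ‖v Pauli.Z‖ ^ 2)
    have hν2 : 0 ≤ ν ^ 2 := sq_nonneg ν
    nlinarith [mul_le_mul_of_nonneg_left hL8 hν2]
  -- sum the slices
  rw [pauliWeight_eq_sum_erase _ hj]
  refine (Finset.sum_le_sum fun S' _ => slice S').trans ?_
  rw [Finset.sum_add_distrib, ← Finset.mul_sum, ← Finset.mul_sum, ← pauliWeight_erase_eq,
    ← pauliWeight_eq_sum_erase M hj]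
  have h1 := hM (W.erase j)
  have h2 := hM W
  rw [Finset.card_erase_of_mem hj] at h1
  have hcard : (2 : ℝ) ^ W.card = 2 * 2 ^ (W.card - 1) := by
    rw [← pow_succ']
    congr 1
    have : 1 ≤ W.card := Finset.card_pos.2 ⟨j, hj⟩
    omega
  have hc : 0 ≤ c := by
    have := (pauliWeight_nonneg M ∅).trans (hM ∅)
    simpa using this
  have hA : 0 ≤ 1 + ν ^ 2 * (1 - 2 * β) := by nlinarith
  have hB : 0 ≤ ν ^ 2 * β := by positivity
  calc (1 + ν ^ 2 * (1 - 2 * β)) * pauliWeight M (W.erase j) + ν ^ 2 * β * pauliWeight M W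
      ≤ (1 + ν ^ 2 * (1 - 2 * β)) * (c * 2 ^ (W.card - 1)) + ν ^ 2 * β * (c * 2 ^ W.card) := by
        gcongr
    _ = (1 + ν ^ 2) / 2 * c * 2 ^ W.card := by rw [hcard]; ring

/-! ### Case 1: noise on a block `A`, then a unitary acting inside `A` -/

/-- **Observation 4 for a list of wires**: depolarizing every wire of the list `L` (in order)
multiplies `Tr(S M)` by `∏_{j ∈ L, S_j ≠ I} (1 − p)`. [cite: KempeEtAl2010, Observation 4] -/
theorem pauliCoeff_foldl_depolarize (p : ℂ) (L : List ι) (M : Matrix (ι → Bool) (ι → Bool) ℂ)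
    (S : ι → Pauli) :
    pauliCoeff (L.foldl (fun N j => (1 - p) • N + p • ((1 / 4 : ℂ) • ∑ Q,
      pauliString (Function.update (fun _ : ι => Pauli.I) j Q) * N *
        pauliString (Function.update (fun _ : ι => Pauli.I) j Q))) M) S =
      (L.map fun j => if S j = Pauli.I then (1 : ℂ) else 1 - p).prod * pauliCoeff M S := by
  induction L generalizing M with
  | nil => simp
  | cons j L ih =>
    rw [List.foldl_cons, ih, pauliCoeff_depolarize, List.map_cons, List.prod_cons]
    ring

omit [Fintype ι] in
/-- The shrinking factor of the noise on a block `A` enumerated without repetition by `L`: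
`∏_{j ∈ L, S_j ≠ I} (1 − p) = (1 − p)^{|supp S ∩ A|}`. [cite: KempeEtAl2010, §3.1.2 Case 1 (μ^{|supp R|})] -/
theorem prod_map_ite_eq_pow {R : Type*} [CommMonoid R] (ν : R) {L : List ι} (hL : L.Nodup)
    (S : ι → Pauli) :
    (L.map fun j => if S j = Pauli.I then (1 : R) else ν).prod =
      ν ^ (L.toFinset.filter fun i => S i ≠ Pauli.I).card := by
  rw [← List.prod_toFinset _ hL, Finset.prod_ite, Finset.prod_const_one, one_mul, Finset.prod_const]

/-- Nonnegative binomial weights sum over supersets: for `s ⊆ A`,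
`Σ_{s ⊆ a ⊆ A} x^{|a|} (1 − x)^{|A| − |a|} = x^{|s|}`. [cite: KempeEtAl2010, §3.1.2 Case 1 ("appears with the same coefficient")] -/
theorem sum_powerset_filter_superset_pow (x : ℝ) {A s : Finset ι} (hs : s ⊆ A) :
    ∑ a ∈ A.powerset with s ⊆ a, x ^ a.card * (1 - x) ^ (A.card - a.card) = x ^ s.card := by
  have himage : (A.powerset.filter fun a => s ⊆ a) = (A \ s).powerset.image fun b => s ∪ b := by
    ext a
    simp only [Finset.mem_filter, Finset.mem_powerset, Finset.mem_image]
    constructor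
    · rintro ⟨haA, hsa⟩
      refine ⟨a \ s, Finset.sdiff_subset_sdiff haA le_rfl, ?_⟩
      rw [Finset.union_sdiff_of_subset hsa]
    · rintro ⟨b, hb, rfl⟩
      exact ⟨Finset.union_subset hs ((hb.trans Finset.sdiff_subset)), Finset.subset_union_left⟩
  rw [himage, Finset.sum_image]
  · have h := Finset.sum_pow_mul_eq_add_pow x (1 - x) (A \ s)
    rw [add_sub_cancel, one_pow, Finset.card_sdiff_of_subset hs] at h
    calc ∑ b ∈ (A \ s).powerset, x ^ (s ∪ b).card * (1 - x) ^ (A.card - (s ∪ b).card)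
        = ∑ b ∈ (A \ s).powerset, x ^ s.card * (x ^ b.card * (1 - x) ^ (A.card - s.card - b.card)) := by
          refine Finset.sum_congr rfl fun b hb => ?_
          have hb' : b ⊆ A \ s := Finset.mem_powerset.1 hb
          have hdisj : Disjoint s b := Finset.disjoint_of_subset_right hb' Finset.disjoint_sdiff
          rw [Finset.card_union_of_disjoint hdisj, pow_add]
          have : A.card - (s.card + b.card) = A.card - s.card - b.card := by omega
          rw [this]
          ring
      _ = x ^ s.card := by rw [← Finset.mul_sum, h, mul_one]
  · intro b hb b' hb' h
    have hb1 : Disjoint s b := Finset.disjoint_of_subset_right (Finset.mem_powerset.1 hb) Finset.disjoint_sdiff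
    have hb2 : Disjoint s b' := Finset.disjoint_of_subset_right (Finset.mem_powerset.1 hb') Finset.disjoint_sdiff
    have := congrArg (fun t => t \ s) h
    simp only [Finset.union_sdiff_left, hb1.symm.sdiff_eq_left, hb2.symm.sdiff_eq_left] at this
    exact this

/-- **Regrouping by the noisy support** (Case 1): for `A ⊆ W'`,
`Σ_{S ∈ 𝒫^{W'}} x^{|supp S ∩ A|} g(S) = Σ_{a ⊆ A} x^{|a|} (1−x)^{|A|−|a|} Σ_{S ∈ 𝒫^{(W'∖A) ∪ a}} g(S)`.
[cite: KempeEtAl2010, §3.1.2 Case 1 (the displayed equality and rearrangement)] -/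
theorem sum_stringsOn_shrink_eq_sum_powerset (x : ℝ) {A W' : Finset ι} (hA : A ⊆ W')
    (g : (ι → Pauli) → ℝ) :
    ∑ S ∈ stringsOn W', x ^ (A.filter fun i => S i ≠ Pauli.I).card * g S =
      ∑ a ∈ A.powerset, x ^ a.card * (1 - x) ^ (A.card - a.card) *
        ∑ S ∈ stringsOn ((W' \ A) ∪ a), g S := by
  -- write the inner sums over the common index set `stringsOn W'`
  have hsub : ∀ a ∈ A.powerset, stringsOn ((W' \ A) ∪ a) ⊆ stringsOn W' := fun a ha =>
    stringsOn_mono (Finset.union_subset Finset.sdiff_subset ((Finset.mem_powerset.1 ha).trans hA))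
  have hmem : ∀ a ∈ A.powerset, ∀ S ∈ stringsOn W',
      (S ∈ stringsOn ((W' \ A) ∪ a) ↔ (A.filter fun i => S i ≠ Pauli.I) ⊆ a) := by
    intro a ha S hS
    rw [mem_stringsOn]
    constructor
    · intro h i hi
      rw [Finset.mem_filter] at hi
      by_contra hia
      exact hi.2 (h i (by simp [hi.1, hia]))
    · intro h i hi
      by_cases hiW : i ∈ W'
      · by_contra hSi
        have hiA : i ∈ A := by
          by_contra hiA
          exact hi (Finset.mem_union_left _ (Finset.mem_sdiff.2 ⟨hiW, hiA⟩))
        have := h (Finset.mem_filter.2 ⟨hiA, hSi⟩)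
        exact hi (Finset.mem_union_right _ this)
      · exact mem_stringsOn.1 hS i hiW
  calc ∑ S ∈ stringsOn W', x ^ (A.filter fun i => S i ≠ Pauli.I).card * g S
      = ∑ S ∈ stringsOn W', (∑ a ∈ A.powerset with (A.filter fun i => S i ≠ Pauli.I) ⊆ a,
          x ^ a.card * (1 - x) ^ (A.card - a.card)) * g S := by
        refine Finset.sum_congr rfl fun S _ => ?_
        rw [sum_powerset_filter_superset_pow x (Finset.filter_subset _ A)]
    _ = ∑ S ∈ stringsOn W', ∑ a ∈ A.powerset,
          (if S ∈ stringsOn ((W' \ A) ∪ a) then x ^ a.card * (1 - x) ^ (A.card - a.card) * g S else 0) := by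
        refine Finset.sum_congr rfl fun S hS => ?_
        rw [Finset.sum_filter, Finset.sum_mul]
        refine Finset.sum_congr rfl fun a ha => ?_
        by_cases hc : (A.filter fun i => S i ≠ Pauli.I) ⊆ a
        · rw [if_pos hc, if_pos ((hmem a ha S hS).2 hc)]
        · rw [if_neg hc, if_neg (fun h' => hc ((hmem a ha S hS).1 h')), zero_mul]
    _ = ∑ a ∈ A.powerset, x ^ a.card * (1 - x) ^ (A.card - a.card) *
          ∑ S ∈ stringsOn ((W' \ A) ∪ a), g S := by
        rw [Finset.sum_comm]
        refine Finset.sum_congr rfl fun a ha => ?_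
        rw [Finset.mul_sum, ← Finset.sum_filter, Finset.filter_mem_eq_inter,
          Finset.inter_eq_right.2 (hsub a ha)]

/-- **Case 1 of Lemma 7: depolarizing noise on a block `A`, then a unitary inside `A`.** Let
`L` enumerate `A` without repetition, `U` be unitary and commute with every single-site Pauli
outside `A`, `0 ≤ p ≤ 1`, and `W ∩ A ≠ ∅`. If `F(M, W') ≤ c 2^{|W'|}` for every `W'`, then
`F(U N_A^p(M) Uᴴ, W) ≤ ((1 + (1−p)²)^{|A|} / 2) · c · 2^{|W|}` — the printed chain
"(lefthand) ≤ … ≤ 2·2^{|V∖A|} θ^{dist V} (1+μ²)^k" with `|V∖A| ≤ |V''| − 1`.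
[cite: KempeEtAl2010, §3.1.2 Case 1] -/
theorem pauliWeight_noisyUnitary_le {A : Finset ι} {L : List ι} (hL : L.Nodup) (hLA : L.toFinset = A)
    (U : Matrix (ι → Bool) (ι → Bool) ℂ) (hU : Uᴴ * U = 1)
    (hcomm : ∀ j, j ∉ A → ∀ Q, pauliString (Function.update (fun _ : ι => Pauli.I) j Q) * U =
      U * pauliString (Function.update (fun _ : ι => Pauli.I) j Q))
    {p : ℝ} (hp0 : 0 ≤ p) (hp1 : p ≤ 1) (M : Matrix (ι → Bool) (ι → Bool) ℂ) {W : Finset ι}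
    (hWA : (W ∩ A).Nonempty) {c : ℝ} (hM : ∀ W' : Finset ι, pauliWeight M W' ≤ c * 2 ^ W'.card) :
    pauliWeight (U * L.foldl (fun N j => (1 - (p : ℂ)) • N + (p : ℂ) • ((1 / 4 : ℂ) • ∑ Q,
      pauliString (Function.update (fun _ : ι => Pauli.I) j Q) * N *
        pauliString (Function.update (fun _ : ι => Pauli.I) j Q))) M * Uᴴ) W ≤
      (1 + (1 - p) ^ 2) ^ A.card / 2 * c * 2 ^ W.card := by
  set ν : ℝ := 1 - p with hν
  have hν0 : 0 ≤ ν := by rw [hν]; linarith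
  have hν1 : ν ≤ 1 := by rw [hν]; linarith
  set N := L.foldl (fun N j => (1 - (p : ℂ)) • N + (p : ℂ) • ((1 / 4 : ℂ) • ∑ Q,
      pauliString (Function.update (fun _ : ι => Pauli.I) j Q) * N *
        pauliString (Function.update (fun _ : ι => Pauli.I) j Q))) M with hN
  have hc : 0 ≤ c := by
    have := (pauliWeight_nonneg M ∅).trans (hM ∅)
    simpa using this
  -- Observation 3 (monotonicity) and Observation 2 (unitary invariance on `W ∪ A`)
  have h1 : pauliWeight (U * N * Uᴴ) W ≤ pauliWeight N (W ∪ A) := by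
    refine (pauliWeight_mono _ (Finset.subset_union_left : W ⊆ W ∪ A)).trans (le_of_eq ?_)
    exact pauliWeight_unitary_conj N U (W ∪ A) hU fun j hj Q =>
      hcomm j (fun hjA => hj (Finset.mem_union_right _ hjA)) Q
  -- Observation 4 on the block
  have h2 : pauliWeight N (W ∪ A) =
      ∑ S ∈ stringsOn (W ∪ A), (ν ^ 2) ^ (A.filter fun i => S i ≠ Pauli.I).card * ‖pauliCoeff M S‖ ^ 2 := by
    rw [pauliWeight_eq]
    refine Finset.sum_congr rfl fun S _ => ?_
    rw [hN, pauliCoeff_foldl_depolarize, prod_map_ite_eq_pow _ hL, hLA, norm_mul, mul_pow, norm_pow,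
      ← Complex.ofReal_one, ← Complex.ofReal_sub, Complex.norm_real, Real.norm_of_nonneg hν0,
      ← pow_mul, mul_comm (A.filter fun i => S i ≠ Pauli.I).card 2, pow_mul]
  -- regroup and use the hypothesis on each `(W ∖ A) ∪ a`
  have h3 : ∑ S ∈ stringsOn (W ∪ A), (ν ^ 2) ^ (A.filter fun i => S i ≠ Pauli.I).card *
      ‖pauliCoeff M S‖ ^ 2 ≤ c * 2 ^ (W \ A).card * (1 + ν ^ 2) ^ A.card := by
    rw [sum_stringsOn_shrink_eq_sum_powerset (ν ^ 2) (Finset.subset_union_right : A ⊆ W ∪ A),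
      Finset.union_sdiff_right]
    have hw : ∀ a ∈ A.powerset, 0 ≤ (ν ^ 2) ^ a.card * (1 - ν ^ 2) ^ (A.card - a.card) := by
      intro a _
      have : 0 ≤ 1 - ν ^ 2 := by nlinarith
      positivity
    calc ∑ a ∈ A.powerset, (ν ^ 2) ^ a.card * (1 - ν ^ 2) ^ (A.card - a.card) *
          ∑ S ∈ stringsOn (W \ A ∪ a), ‖pauliCoeff M S‖ ^ 2
        ≤ ∑ a ∈ A.powerset, (ν ^ 2) ^ a.card * (1 - ν ^ 2) ^ (A.card - a.card) *
          (c * 2 ^ ((W \ A).card + a.card)) := by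
          refine Finset.sum_le_sum fun a ha => mul_le_mul_of_nonneg_left ?_ (hw a ha)
          refine ((pauliWeight_eq M _).symm.le.trans (hM _)).trans ?_
          gcongr
          · norm_num
          · exact Finset.card_union_le _ _
      _ = c * 2 ^ (W \ A).card * ∑ a ∈ A.powerset, (2 * ν ^ 2) ^ a.card * (1 - ν ^ 2) ^ (A.card - a.card) := by
          rw [Finset.mul_sum]
          refine Finset.sum_congr rfl fun a _ => ?_
          rw [pow_add, mul_pow]
          ring
      _ = c * 2 ^ (W \ A).card * (1 + ν ^ 2) ^ A.card := by
          rw [Finset.sum_pow_mul_eq_add_pow]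
          ring_nf
  -- `|W ∖ A| ≤ |W| - 1`
  have hcard : (2 : ℝ) ^ (W \ A).card ≤ 2 ^ W.card / 2 := by
    have h := Finset.card_sdiff_add_card_inter W A
    have hpos : 1 ≤ (W ∩ A).card := Finset.card_pos.2 hWA
    have : (W \ A).card + 1 ≤ W.card := by omega
    have h2 : (2 : ℝ) ^ ((W \ A).card + 1) ≤ 2 ^ W.card := pow_le_pow_right₀ (by norm_num) this
    rw [pow_succ] at h2
    linarith
  calc pauliWeight (U * N * Uᴴ) W ≤ c * 2 ^ (W \ A).card * (1 + ν ^ 2) ^ A.card := h1.trans (h2.le.trans h3)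
    _ ≤ c * (2 ^ W.card / 2) * (1 + ν ^ 2) ^ A.card := by gcongr
    _ = (1 + ν ^ 2) ^ A.card / 2 * c * 2 ^ W.card := by ring

end Literature.Computability.QuantumComplexity
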